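import Literature.AlgebraicGeometry.Frobenioids.ArchimedeanFSMMonoCondBR
import Literature.AlgebraicGeometry.Frobenioids.ArchimedeanFSMProofs
import HarnessLib

/-!
# Frobenioids II, Proposition 3.4 (iii) along the printed route: FSM-morphisms satisfying (ii)(a) or
# (ii)(b) project to FSM-morphisms of `D` — PROOF
# (abc-iut cell, layer L1, node `FrdII:Prop3.4(iii)` / FLAGS F2 repair supplement, chain LC-L1-2)

Mochizuki, *The geometry of Frobenioids II: poly-Frobenioids*, Kyushu J. Math. **62** (2008)
401–460, §3, Proposition 3.4 (iii) p. 30: "FSM-morphisms of `F` project to FSM-morphisms of `D`",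
proof p. 31 ll. 6–9: "Assertion (iii) follows immediately from assertions (i), (ii), together with the
observation that if `φ` is a fiberwise-surjective morphism of `F` that does not satisfy condition (a)
of assertion (ii), then the fiberwise-surjectivity of `φ` implies [cf. Lemma 3.2, (ix)] that `φ`
necessarily satisfies condition (b) of assertion (ii)." [cite: MochizukiFrdII2008, Prop 3.4 (iii) p.30]

PROOF-ONLY companion of `ArchimedeanFSM.lean` (statements, abc-iut-L1-t6); nothing is defined here.

Item (iii) as typed and as printed is FALSE at `π = 𝟭 D₀` (`ArchFrd.not_prop34_iii_id`,
`towerA/N/R_id_not_propIII`, abc-iut-L1-d3: the quoted "observation" fails for a complex → real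
arrow, whose fiberwise-surjectivity only controls the union of the angular region with its complex
conjugate). What the printed route DOES prove is recorded here, for `F = A, N, R` over an ARBITRARY
base `π : D ⥤ D₀`: an FSM-morphism of `F` satisfying condition (a) or condition (b) of (ii) projects to
an FSM-morphism of `D` — assertions (i) (`ArchFrd.prop34_i_holds`, abc-iut-L1-d3) and (ii)
(`ArchFrd.prop34_ii_holds`, abc-iut-w5-d101) composed. This contains the complex-regime repair
(`ArchFrd.prop34_iii_of_isComplex`, where (a) always holds) and also covers real → real arrows and the
complex → real arrows allowed by (b). No statement of the paper is strengthened; no side is taken on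
[IUTchIII] Cor. 3.12.
-/

namespace Literature.AlgebraicGeometry.Frobenioids

open CategoryTheory

namespace ArchFrd

universe v u

variable {D : Type u} [Category.{v} D] (π : D ⥤ D0)

/-- For any tower satisfying (i) and (ii): an FSM-morphism with (ii)(a) or (ii)(b) projects to an
FSM-morphism of `D` (fiberwise-surjective by (i), mono by (ii)). [cite: MochizukiFrdII2008, Prop 3.4 (iii) p.30] -/
theorem Tower.isFSM_toD_of_condA_or_condB (T : Tower π) (hI : T.PropI) (hII : T.PropII)
    {X Y : T.F} (φ : X ⟶ Y) (hφ : IsFSM φ) (hab : T.CondA φ ∨ T.CondB φ) :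
    IsFSM (T.toD.map φ) :=
  ⟨hI φ hφ.1, hII φ hφ.2 hab⟩

/-- **Prop. 3.4 (iii) along the printed route, `F = A`**: an FSM-morphism of the angular Frobenioid
satisfying (ii)(a) or (ii)(b) projects to an FSM-morphism of `D`. [cite: MochizukiFrdII2008, Prop 3.4 (iii) p.30] -/
theorem A.isFSM_toD_of_condA_or_condB {X Y : (towerA π).F} (φ : X ⟶ Y) (hφ : IsFSM φ)
    (hab : (towerA π).CondA φ ∨ (towerA π).CondB φ) : IsFSM ((towerA π).toD.map φ) :=
  (towerA π).isFSM_toD_of_condA_or_condB π (prop34_i_holds π).1 (prop34_ii_holds π).1 φ hφ hab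

/-- **Prop. 3.4 (iii) along the printed route, `F = N`** (non-rigidified angloid).
[cite: MochizukiFrdII2008, Prop 3.4 (iii) p.30] -/
theorem N.isFSM_toD_of_condA_or_condB {X Y : (towerN π).F} (φ : X ⟶ Y) (hφ : IsFSM φ)
    (hab : (towerN π).CondA φ ∨ (towerN π).CondB φ) : IsFSM ((towerN π).toD.map φ) :=
  (towerN π).isFSM_toD_of_condA_or_condB π (prop34_i_holds π).2.1 (prop34_ii_holds π).2.1 φ hφ hab

/-- **Prop. 3.4 (iii) along the printed route, `F = R`** (rigidified angloid).
[cite: MochizukiFrdII2008, Prop 3.4 (iii) p.30] -/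
theorem R.isFSM_toD_of_condA_or_condB {X Y : (towerR π).F} (φ : X ⟶ Y) (hφ : IsFSM φ)
    (hab : (towerR π).CondA φ ∨ (towerR π).CondB φ) : IsFSM ((towerR π).toD.map φ) :=
  (towerR π).isFSM_toD_of_condA_or_condB π (prop34_i_holds π).2.2 (prop34_ii_holds π).2.2 φ hφ hab

/-- **Prop. 3.4 (iii) along the printed route, all three towers, bundled**: for `F = A, N, R` over an
arbitrary base `π : D ⥤ D₀`, every FSM-morphism of `F` satisfying condition (a) or (b) of (ii)
projects to an FSM-morphism of `D`. (The unconditioned item is `Prop34_iii π`, false at `π = 𝟭 D₀`.)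
[cite: MochizukiFrdII2008, Prop 3.4 (iii) p.30] -/
theorem prop34_iii_of_condA_or_condB :
    (∀ ⦃X Y : (towerA π).F⦄ (φ : X ⟶ Y), IsFSM φ → ((towerA π).CondA φ ∨ (towerA π).CondB φ) →
        IsFSM ((towerA π).toD.map φ)) ∧
      (∀ ⦃X Y : (towerN π).F⦄ (φ : X ⟶ Y), IsFSM φ → ((towerN π).CondA φ ∨ (towerN π).CondB φ) →
          IsFSM ((towerN π).toD.map φ)) ∧
        ∀ ⦃X Y : (towerR π).F⦄ (φ : X ⟶ Y), IsFSM φ → ((towerR π).CondA φ ∨ (towerR π).CondB φ) →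
          IsFSM ((towerR π).toD.map φ) :=
  ⟨fun _ _ φ hφ hab => A.isFSM_toD_of_condA_or_condB π φ hφ hab,
    fun _ _ φ hφ hab => N.isFSM_toD_of_condA_or_condB π φ hφ hab,
    fun _ _ φ hφ hab => R.isFSM_toD_of_condA_or_condB π φ hφ hab⟩

/-- In particular the typed item (iii) holds for every base over which every FSM-morphism of each
tower satisfies (a) or (b) (e.g. the complex regime, where (a) always holds —
`ArchFrd.prop34_iii_of_isComplex`). [cite: MochizukiFrdII2008, Prop 3.4 (iii) p.30] -/
theorem prop34_iii_of_forall_condA_or_condB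
    (hA : ∀ ⦃X Y : (towerA π).F⦄ (φ : X ⟶ Y), IsFSM φ → (towerA π).CondA φ ∨ (towerA π).CondB φ)
    (hN : ∀ ⦃X Y : (towerN π).F⦄ (φ : X ⟶ Y), IsFSM φ → (towerN π).CondA φ ∨ (towerN π).CondB φ)
    (hR : ∀ ⦃X Y : (towerR π).F⦄ (φ : X ⟶ Y), IsFSM φ → (towerR π).CondA φ ∨ (towerR π).CondB φ) :
    Prop34_iii π :=
  ⟨fun _ _ φ hφ => A.isFSM_toD_of_condA_or_condB π φ hφ (hA φ hφ),
    fun _ _ φ hφ => N.isFSM_toD_of_condA_or_condB π φ hφ (hN φ hφ),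
    fun _ _ φ hφ => R.isFSM_toD_of_condA_or_condB π φ hφ (hR φ hφ)⟩

end ArchFrd

end Literature.AlgebraicGeometry.Frobenioids
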